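import Mathlib.Data.ZMod.Basic
import Mathlib.Algebra.Module.Prod
import Mathlib.Tactic.LinearCombination
import Mathlib.Tactic.Ring

/-!
# Kernels of surjections `(ℤ/lℤ)² ↠ ℤ/lℤ` are cyclic (support for [EtTh] Prop 2.2)

Mochizuki, *The Étale Theta Function …* [EtTh], Publ. RIMS 45 (2009), §2, Prop 2.2, PRIMS text
p.37 (locators `p.N` = PDF pages; bib key `MochizukiEtTh2009`): "`Δ̄^ell_X` is a free
`(ℤ/lℤ)`-module of rank `2`" (p.35) and the covering `X̲ → X` is cut out by "a quotient onto a free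
`(ℤ/lℤ)`-module `Q` of rank `1`" (Def 2.1, p.36), so that "the geometric portion `Δ_X̲̲` … maps
isomorphically onto `Δ̄^ell_X̲` [hence is a cyclic group of order `l`]" (Prop 2.2 (ii), p.37).
The group-theoretic content used by the discharge of Prop 2.2 (i) (`Discharge/Sec2InversionProofs`,
unit W2-L2-06, abc-iut-L2-t10) is the elementary fact PROVED here by an explicit unimodular
computation: the kernel of a surjective additive map `(ℤ/lℤ)² → ℤ/lℤ` is generated by one
element (for every `l : ℕ`, no primality needed). Mathlib-only; proof-only (no `def`).
-/

namespace Literature.AnabelianGeometry.EtaleTheta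

namespace ThetaCovers

/-! ## Kernels of surjections `(ℤ/lℤ)² ↠ ℤ/lℤ` are cyclic -/

/-- An additive endomorphism of `ℤ/lℤ` is multiplication by its value at `1`.
[cite: MochizukiEtTh2009, Prop 2.2(i) p.37] -/
theorem zmod_addMonoidHom_apply_eq_mul {l : ℕ} (g : ZMod l →+ ZMod l) (a : ZMod l) :
    g a = a * g 1 := by
  have ha : a = ((a.cast : ℤ)) • (1 : ZMod l) := by
    rw [zsmul_eq_mul, mul_one, ZMod.intCast_zmod_cast]
  conv_lhs => rw [ha, map_zsmul]
  rw [zsmul_eq_mul, ZMod.intCast_zmod_cast]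

/-- An additive map `(ℤ/lℤ)² → ℤ/lℤ` in coordinates. [cite: MochizukiEtTh2009, Prop 2.2(i) p.37] -/
theorem zmod_prod_addMonoidHom_apply {l : ℕ} (f : ZMod l × ZMod l →+ ZMod l)
    (x : ZMod l × ZMod l) : f x = x.1 * f (1, 0) + x.2 * f (0, 1) := by
  have hx : x = (x.1, (0 : ZMod l)) + ((0 : ZMod l), x.2) := by ext <;> simp
  conv_lhs => rw [hx, map_add]
  have h1 : f (x.1, 0) = x.1 * f (1, 0) :=
    zmod_addMonoidHom_apply_eq_mul (f.comp (AddMonoidHom.inl (ZMod l) (ZMod l))) x.1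
  have h2 : f (0, x.2) = x.2 * f (0, 1) :=
    zmod_addMonoidHom_apply_eq_mul (f.comp (AddMonoidHom.inr (ZMod l) (ZMod l))) x.2
  rw [h1, h2]

/-- **The kernel of a surjection `(ℤ/lℤ)² ↠ ℤ/lℤ` is cyclic** ("`Δ̄^ell_X̲` … hence is a cyclic
group of order `l`", Prop 2.2 (ii)): if `f(a, b) = a·u + b·u' ` hits `1` at `(v₁, v₂)`, then
`w = (−u', u)` lies in the kernel and `x = (v₁x₂ − v₂x₁)·w` for every `x` in the kernel.
[cite: MochizukiEtTh2009, Prop 2.2(ii) p.37] -/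
theorem zmod_ker_cyclic {l : ℕ} (f : ZMod l × ZMod l →+ ZMod l) (hf : Function.Surjective f) :
    ∃ w : ZMod l × ZMod l, f w = 0 ∧ ∀ x, f x = 0 → ∃ n : ZMod l, x = n • w := by
  obtain ⟨v, hv⟩ := hf 1
  have hv' : v.1 * f (1, 0) + v.2 * f (0, 1) = 1 := by
    rw [← zmod_prod_addMonoidHom_apply]; exact hv
  refine ⟨(-f (0, 1), f (1, 0)), ?_, fun x hx => ?_⟩
  · rw [zmod_prod_addMonoidHom_apply]; ring
  · rw [zmod_prod_addMonoidHom_apply] at hx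
    refine ⟨v.1 * x.2 - v.2 * x.1, Prod.ext ?_ ?_⟩
    · simp only [Prod.smul_mk, smul_eq_mul]
      linear_combination (-x.1) * hv' + v.1 * hx
    · simp only [Prod.smul_mk, smul_eq_mul]
      linear_combination (-x.2) * hv' + v.2 * hx

end ThetaCovers

end Literature.AnabelianGeometry.EtaleTheta
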